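import Summits.MatrixMultiplication.MatrixMultiplication.Theorems.SnLevelDesigns.Negative.DeadCorners
import Summits.MatrixMultiplication.MatrixMultiplication.Theorems.SnLevelDesigns.Negative.DimensionWalls
import Literature.NumberTheory.DiophantineGeometry.SchurWeylPlethysmHwMultiplicityProofs
import Literature.RepresentationTheory.FiniteGroups.AldousOrderProofs

/-!
# `SnLevelDesigns` (crux stmt-MatrixMultiplication-7613, route `LevelGradedCohnUmans`):
# level 1 is dead (negative-side support, refuter cdisprove seat)

Sorry-free.  `not_at_level_one`: for every `n` and every `0 < ε ≤ 1` no `1`-token separated triple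
`X, Y, Z ⊆ 𝔖ₙ` satisfies the crux inequality (for `n ≥ 3` this holds for every `ε > 0`,
`not_at_level_one_of_three_le`; at `n = 2` exactly for `ε ≤ 1`).  So in the relevant regime
`ε → 0` any proof of the crux uses `k ≥ 2` — the route's "level 1 is EMPTY" as a theorem.
Ingredients: `numStandardTableaux_twoRow` (`f^{(n-1,1)} = n - 1`, the tree's Frobenius formula with
two rows) ⇒ `budget_one_ge` (`budget n 1 ε ≥ 1 + (n-1)^{2+ε}`); `finrank_tokenSpace_one_le`
(`dim T_1 ≤ (n-1)² + 1`: the entries `[g i = j]`, `i, j < n-1`, and `1` span `T_1`); the three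
dimension walls (`DimensionWalls.lean`) and integrality (`mul_mul_le_cube_of_pairwise`: pairwise
products `≤ N²+1`, `N ≥ 2` ⇒ triple product `≤ N³`) ⇒ `|X||Y||Z| ≤ (n-1)³`, whence
`volume^{(2+ε)/3} ≤ (n-1)^{2+ε} < budget`.
-/

namespace Summit.MatrixMultiplication.MatrixMultiplication.Theorems.SnLevelDesigns.Negative

open scoped BigOperators
open Literature.NumberTheory.DiophantineGeometry (numStandardTableaux numStandardTableaux_pos_holds)

noncomputable section

/-! ## Level `k = 1` is dead (the window `(c₁(3), c₁(2)] = (1, 1]` is empty)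

Ingredients: `f^{(n-1,1)} = n - 1` (Frobenius formula with two rows), so
`budget n 1 ε ≥ 1 + (n-1)^{2+ε}`; `dim T_1 ≤ (n-1)² + 1` (the permutation-matrix entries
`[g i = j]`, `i, j < n-1`, and the constant `1` span `T_1`); the three walls and INTEGRALITY:
pairwise products `≤ (n-1)²+1` force `|X||Y||Z| ≤ (n-1)³` for `n ≥ 3`; hence
`volume^{(2+ε)/3} ≤ (n-1)^{2+ε} < budget`.  For `n = 2` the same holds iff `ε ≤ 1`
(`n = 2, k = 1, X = 𝔖₂, Y = Z = {1}` works for `ε > 1`). -/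

/-- The partition `(n-1, 1)` of `n ≥ 2`. -/
def twoRow (n : ℕ) (hn : 2 ≤ n) : Nat.Partition n where
  parts := {n - 1, 1}
  parts_pos h := by
    simp only [Multiset.insert_eq_cons, Multiset.mem_cons, Multiset.mem_singleton] at h
    omega
  parts_sum := by
    simp only [Multiset.insert_eq_cons, Multiset.sum_cons, Multiset.sum_singleton]
    omega

/-- The parts of `twoRow n`. -/
theorem twoRow_parts (n : ℕ) (hn : 2 ≤ n) : (twoRow n hn).parts = ({n - 1, 1} : Multiset ℕ) := rfl

/-- The largest part of `(n-1, 1)` is `n - 1`. -/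
theorem twoRow_sup (n : ℕ) (hn : 2 ≤ n) : (twoRow n hn).parts.sup = n - 1 := by
  rw [twoRow_parts]
  simp only [Multiset.insert_eq_cons, Multiset.sup_cons, Multiset.sup_singleton]
  exact max_eq_left (by omega)

/-- `(n-1, 1) ≠ (n)`. -/
theorem twoRow_ne_indiscrete (n : ℕ) (hn : 2 ≤ n) : twoRow n hn ≠ Nat.Partition.indiscrete n :=
  Literature.RepresentationTheory.FiniteGroups.ne_indiscrete_of_parts_eq (twoRow_parts n hn)

/-- `f^{(n-1,1)} = n - 1` (Frobenius–Young degree formula of the tree with `N = 2` rows: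
`f · n! · 1! = n! · (n - 1)`). -/
theorem numStandardTableaux_twoRow (n : ℕ) (hn : 2 ≤ n) :
    numStandardTableaux (twoRow n hn) = n - 1 := by
  classical
  set μ := twoRow n hn with hμ
  have hsp : μ.sortedParts = [n - 1, 1] :=
    Literature.RepresentationTheory.FiniteGroups.sortedParts_twoRow (twoRow_parts n hn)
  rw [Literature.NumberTheory.DiophantineGeometry.numStandardTableaux_eq_card_stdFilling]
  have hN : ∀ c ∈ μ.youngDiagram.cells, c.1 < 2 := fun c hc =>
    Literature.NumberTheory.DiophantineGeometry.fst_lt_of_mem_youngDiagram μ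
      (by rw [twoRow_parts]; simp) hc
  have hrow0 : μ.youngDiagram.rowLen 0 = n - 1 := by
    rw [Literature.NumberTheory.DiophantineGeometry.rowLen_youngDiagram, hsp]; rfl
  have hrow1 : μ.youngDiagram.rowLen 1 = 1 := by
    rw [Literature.NumberTheory.DiophantineGeometry.rowLen_youngDiagram, hsp]; rfl
  have key := Literature.NumberTheory.DiophantineGeometry.card_stdFilling_mul_prod_factorial
    2 n μ.youngDiagram μ.card_cells_youngDiagram hN
  have hI0 : Finset.Ioo 0 2 = {1} := by decide
  have hI1 : Finset.Ioo 1 2 = ∅ := by decide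
  simp only [Finset.prod_range_succ, Finset.range_one, Finset.prod_singleton, hrow0, hrow1, hI0, hI1,
    Finset.prod_empty, mul_one, Nat.sub_self, add_zero] at key
  -- key : card * (n - 1 + 1)! = n! * (↑(n - 1 + 1) - 1)  (in ℚ)
  have h1 : n - 1 + (2 - 1 - 0) = n := by omega
  rw [h1] at key
  try simp only [Nat.factorial_one, Nat.cast_one, mul_one] at key
  have hfac : (n.factorial : ℚ) ≠ 0 := by exact_mod_cast n.factorial_ne_zero
  have hcast : ((n - 1 : ℕ) : ℚ) = (n : ℚ) - 1 := by
    rw [Nat.cast_sub (by omega), Nat.cast_one]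
  have : (Nat.card (Literature.NumberTheory.DiophantineGeometry.StdFilling n μ.youngDiagram) : ℚ)
      = ((n - 1 : ℕ) : ℚ) := by
    rw [hcast]
    exact mul_right_cancel₀ hfac (key.trans (mul_comm _ _))
  exact_mod_cast this

/-- At level 1 the budget is at least `1 + (n-1)^{2+ε}` (`n ≥ 2`, `2 + ε ≥ 0`). -/
theorem budget_one_ge {n : ℕ} (hn : 2 ≤ n) (ε : ℝ) :
    1 + ((n - 1 : ℕ) : ℝ) ^ (2 + ε) ≤ budget n 1 ε := by
  classical
  unfold budget
  have hterm : ∀ μ : Nat.Partition n, 0 ≤ (if n - 1 ≤ μ.parts.sup then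
      (numStandardTableaux μ : ℝ) ^ (2 + ε) else 0) := by
    intro μ; split_ifs
    · positivity
    · exact le_rfl
  have hsub : ({Nat.Partition.indiscrete n, twoRow n hn} : Finset (Nat.Partition n)) ⊆ Finset.univ :=
    Finset.subset_univ _
  refine le_trans ?_ (Finset.sum_le_sum_of_subset_of_nonneg hsub (fun μ _ _ => hterm μ))
  rw [Finset.sum_pair (twoRow_ne_indiscrete n hn).symm, if_pos (indiscrete_sup_ge n 1),
    numStandardTableaux_indiscrete, if_pos (by rw [twoRow_sup]), numStandardTableaux_twoRow]
  simp

/-! ### `dim T_1 ≤ (n-1)² + 1` -/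

/-- The permutation-matrix entry `[g i = j]` as a function on `𝔖ₙ`. -/
def entryFn {n : ℕ} (i j : Fin n) (g : Equiv.Perm (Fin n)) : ℂ := if g i = j then 1 else 0

/-- Row sums of a permutation matrix are `1`. -/
theorem sum_entryFn_right {n : ℕ} (i : Fin n) : ∑ j, entryFn i j = (1 : Equiv.Perm (Fin n) → ℂ) := by
  funext g
  simp [entryFn, Finset.sum_apply]

/-- Column sums of a permutation matrix are `1`. -/
theorem sum_entryFn_left {n : ℕ} (j : Fin n) : ∑ i, entryFn i j = (1 : Equiv.Perm (Fin n) → ℂ) := by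
  funext g
  simp only [Finset.sum_apply, entryFn, Pi.one_apply]
  simp_rw [Equiv.apply_eq_iff_eq_symm_apply g]
  simp

/-- The spanning family: entries `[g i = j]` with `i, j < m` and the constant `1` (`n = m + 1`). -/
def smallFamily (m : ℕ) : Option (Fin m × Fin m) → (Equiv.Perm (Fin (m + 1)) → ℂ)
  | none => 1
  | some ij => entryFn (Fin.castSucc ij.1) (Fin.castSucc ij.2)

/-- Every entry function lies in the span of the small family (row/column relations). -/
theorem entryFn_mem_span (m : ℕ) (i j : Fin (m + 1)) :
    entryFn i j ∈ Submodule.span ℂ (Set.range (smallFamily m)) := by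
  set S := Submodule.span ℂ (Set.range (smallFamily m)) with hS
  have hone : (1 : Equiv.Perm (Fin (m + 1)) → ℂ) ∈ S := Submodule.subset_span ⟨none, rfl⟩
  have hsmall : ∀ i' j' : Fin m, entryFn (Fin.castSucc i') (Fin.castSucc j') ∈ S :=
    fun i' j' => Submodule.subset_span ⟨some (i', j'), rfl⟩
  -- rows with `i < m`: the last column entry from the row relation
  have hrow : ∀ i' : Fin m, ∀ j : Fin (m + 1), entryFn (Fin.castSucc i') j ∈ S := by
    intro i' j
    induction j using Fin.lastCases with
    | cast j' => exact hsmall i' j'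
    | last =>
      have h := sum_entryFn_right (n := m + 1) (Fin.castSucc i')
      rw [Fin.sum_univ_castSucc] at h
      have : entryFn (Fin.castSucc i') (Fin.last m) =
          1 - ∑ j' : Fin m, entryFn (Fin.castSucc i') (Fin.castSucc j') := by
        rw [← h]; abel
      rw [this]
      exact S.sub_mem hone (S.sum_mem fun j' _ => hsmall i' j')
  induction i using Fin.lastCases with
  | cast i' => exact hrow i' j
  | last =>
    have h := sum_entryFn_left (n := m + 1) j
    rw [Fin.sum_univ_castSucc] at h
    have : entryFn (Fin.last m) j = 1 - ∑ i' : Fin m, entryFn (Fin.castSucc i') j := by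
      rw [← h]; abel
    rw [this]
    exact S.sub_mem hone (S.sum_mem fun i' _ => hrow i' j)

/-- `T_1` is spanned by the small family. -/
theorem tokenSpace_one_le_span (m : ℕ) :
    tokenSpace (m + 1) 1 ≤ Submodule.span ℂ (Set.range (smallFamily m)) := by
  rintro f ⟨c, rfl⟩
  -- `tokenFn c = ∑_{i j} c (const i) (const j) • entryFn i j`
  have hf : (tokenMap (m + 1) 1 c : Equiv.Perm (Fin (m + 1)) → ℂ) =
      ∑ i : Fin (m + 1), ∑ j : Fin (m + 1), c (fun _ => i) (fun _ => j) • entryFn i j := by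
    funext g
    change tokenFn c g = _
    unfold tokenFn
    simp only [Finset.sum_apply, Pi.smul_apply, smul_eq_mul, entryFn, mul_ite, mul_one, mul_zero,
      Finset.sum_ite_eq, Finset.mem_univ, if_true]
    rw [← (Equiv.funUnique (Fin 1) (Fin (m + 1))).symm.sum_comp]
    refine Finset.sum_congr rfl fun i _ => ?_
    congr 1
  rw [hf]
  refine Submodule.sum_mem _ fun i _ => Submodule.sum_mem _ fun j _ => ?_
  exact Submodule.smul_mem _ _ (entryFn_mem_span m i j)

/-- `dim T_1 ≤ (n-1)² + 1`. -/
theorem finrank_tokenSpace_one_le (n : ℕ) (hn : 1 ≤ n) :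
    Module.finrank ℂ (tokenSpace n 1) ≤ (n - 1) ^ 2 + 1 := by
  obtain ⟨m, rfl⟩ : ∃ m, n = m + 1 := ⟨n - 1, by omega⟩
  simp only [Nat.add_sub_cancel]
  calc Module.finrank ℂ (tokenSpace (m + 1) 1)
      ≤ Module.finrank ℂ (Submodule.span ℂ (Set.range (smallFamily m))) :=
        Submodule.finrank_mono (tokenSpace_one_le_span m)
    _ ≤ Fintype.card (Option (Fin m × Fin m)) := finrank_range_le_card _
    _ = m ^ 2 + 1 := by simp [Fintype.card_option, Fintype.card_prod, Fintype.card_fin, sq]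

/-! ### Integrality and the level-1 verdict -/

/-- Pairwise products `≤ N² + 1` with `N ≥ 2` force the triple product `≤ N³`. -/
theorem mul_mul_le_cube_of_pairwise {a b c N : ℕ} (hN : 2 ≤ N) (hab : a * b ≤ N ^ 2 + 1)
    (hbc : b * c ≤ N ^ 2 + 1) (hac : a * c ≤ N ^ 2 + 1) : a * b * c ≤ N ^ 3 := by
  have small : ∀ {u v : ℕ}, u * v ≤ N ^ 2 + 1 → N + 1 ≤ u → v ≤ N - 1 := by
    intro u v huv hu
    have h1 : v * (N + 1) ≤ N ^ 2 + 1 := le_trans (by nlinarith) huv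
    have h2 : N ^ 2 + 1 < N * (N + 1) := by nlinarith
    have h3 : v < N := Nat.lt_of_mul_lt_mul_right (lt_of_le_of_lt h1 h2)
    omega
  have big : (N ^ 2 + 1) * (N - 1) ≤ N ^ 3 := by
    obtain ⟨M, rfl⟩ : ∃ M, N = M + 1 := ⟨N - 1, by omega⟩
    simp only [Nat.add_sub_cancel]
    nlinarith
  by_cases ha : a ≤ N
  · by_cases hb : b ≤ N
    · by_cases hc : c ≤ N
      · calc a * b * c ≤ N * N * N := by gcongr
          _ = N ^ 3 := by ring
      · push Not at hc
        have hb' := small (by rwa [mul_comm] at hbc) hc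
        have ha' := small (by rwa [mul_comm] at hac) hc
        calc a * b * c = (b * c) * a := by ring
          _ ≤ (N ^ 2 + 1) * (N - 1) := Nat.mul_le_mul hbc ha'
          _ ≤ N ^ 3 := big
    · push Not at hb
      have hc' := small hbc hb
      have ha' := small (by rwa [mul_comm] at hab) hb
      calc a * b * c = (a * b) * c := by ring
        _ ≤ (N ^ 2 + 1) * (N - 1) := Nat.mul_le_mul hab hc'
        _ ≤ N ^ 3 := big
  · push Not at ha
    have hb' := small hab ha
    have hc' := small hac ha
    calc a * b * c = (a * c) * b := by ring
      _ ≤ (N ^ 2 + 1) * (N - 1) := Nat.mul_le_mul hac hb'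
      _ ≤ N ^ 3 := big

/-- For a `1`-token separated triple in `𝔖ₙ`, `n ≥ 3`: `|X||Y||Z| ≤ (n-1)³`. -/
theorem volume_le_cube_of_sep_one {n : ℕ} (hn : 3 ≤ n) {X Y Z : Finset (Equiv.Perm (Fin n))}
    (h : Sep n 1 X Y Z) : X.card * Y.card * Z.card ≤ (n - 1) ^ 3 := by
  classical
  rcases X.eq_empty_or_nonempty with hX | hX
  · simp [hX]
  rcases Y.eq_empty_or_nonempty with hY | hY
  · simp [hY]
  rcases Z.eq_empty_or_nonempty with hZ | hZ
  · simp [hZ]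
  have hD := finrank_tokenSpace_one_le n (by omega)
  exact mul_mul_le_cube_of_pairwise (N := n - 1) (by omega)
    ((card_X_mul_card_Y_le_finrank h hZ).trans hD)
    ((card_Y_mul_card_Z_le_finrank h hX).trans hD)
    ((card_X_mul_card_Z_le_finrank h hY).trans hD)

/-- **LEVEL 1 IS DEAD for `n ≥ 3` and every `ε > 0`.** -/
theorem not_at_level_one_of_three_le {ε : ℝ} (hε : 0 < ε) {n : ℕ} (hn : 3 ≤ n)
    (X Y Z : Finset (Equiv.Perm (Fin n))) : ¬ At ε n 1 X Y Z := by
  rintro ⟨hsep, hlt⟩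
  have hV := volume_le_cube_of_sep_one hn hsep
  have hB := budget_one_ge (n := n) (by omega) ε
  set N : ℕ := n - 1 with hNdef
  have hNpos : (0 : ℝ) ≤ (N : ℝ) := by positivity
  have hvol : volPow ε X Y Z ≤ (N : ℝ) ^ (2 + ε) := by
    unfold volPow
    have hcast : ((X.card * Y.card * Z.card : ℕ) : ℝ) ≤ ((N : ℝ) ^ (3 : ℕ)) := by
      exact_mod_cast hV
    calc ((X.card * Y.card * Z.card : ℕ) : ℝ) ^ ((2 + ε) / 3)
        ≤ ((N : ℝ) ^ (3 : ℕ)) ^ ((2 + ε) / 3) :=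
          Real.rpow_le_rpow (by positivity) hcast (by positivity)
      _ = (N : ℝ) ^ (2 + ε) := by
          rw [← Real.rpow_natCast, ← Real.rpow_mul hNpos]
          congr 1; push_cast; ring
  linarith

/-- Level 1 at `n = 2`: pairwise products `≤ 2` force volume `≤ 2`. -/
theorem volume_le_two_of_sep_one_two {X Y Z : Finset (Equiv.Perm (Fin 2))} (h : Sep 2 1 X Y Z) :
    X.card * Y.card * Z.card ≤ 2 := by
  classical
  rcases X.eq_empty_or_nonempty with hX | hX
  · simp [hX]
  rcases Y.eq_empty_or_nonempty with hY | hY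
  · simp [hY]
  rcases Z.eq_empty_or_nonempty with hZ | hZ
  · simp [hZ]
  have hD : Module.finrank ℂ (tokenSpace 2 1) ≤ 2 := by
    have := finrank_tokenSpace_one_le 2 (by norm_num); simpa using this
  have h1 := (card_X_mul_card_Y_le_finrank h hZ).trans hD
  have h2 := (card_Y_mul_card_Z_le_finrank h hX).trans hD
  have h3 := (card_X_mul_card_Z_le_finrank h hY).trans hD
  have ha := hX.card_pos; have hb := hY.card_pos; have hc := hZ.card_pos
  set a := X.card; set b := Y.card; set c := Z.card
  -- a*b ≤ 2, b*c ≤ 2, a*c ≤ 2, all ≥ 1 ⇒ abc ≤ 2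
  rcases Nat.lt_or_ge 1 a with ha2 | ha1
  · have hb1 : b ≤ 1 := by nlinarith
    have hc1 : c ≤ 1 := by nlinarith
    calc a * b * c ≤ a * b * 1 := by gcongr
      _ ≤ 2 := by simpa using h1
  · calc a * b * c ≤ 1 * b * c := by gcongr
      _ = b * c := by ring
      _ ≤ 2 := h2

/-- **LEVEL 1 IS DEAD at `n = 2` for `ε ≤ 1`** (and alive for `ε > 1`: `X = 𝔖₂, Y = Z = {1}`). -/
theorem not_at_level_one_two {ε : ℝ} (hε : 0 < ε) (hε1 : ε ≤ 1)
    (X Y Z : Finset (Equiv.Perm (Fin 2))) : ¬ At ε 2 1 X Y Z := by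
  rintro ⟨hsep, hlt⟩
  have hV := volume_le_two_of_sep_one_two hsep
  have hB := budget_one_ge (n := 2) le_rfl ε
  norm_num at hB
  have hvol : volPow ε X Y Z ≤ 2 := by
    unfold volPow
    calc ((X.card * Y.card * Z.card : ℕ) : ℝ) ^ ((2 + ε) / 3)
        ≤ (2 : ℝ) ^ ((2 + ε) / 3) := Real.rpow_le_rpow (by positivity) (by exact_mod_cast hV) (by positivity)
      _ ≤ (2 : ℝ) ^ (1 : ℝ) := Real.rpow_le_rpow_of_exponent_le (by norm_num) (by linarith)
      _ = 2 := Real.rpow_one 2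
  linarith

/-- **LEVEL 1 IS DEAD for every `n` whenever `0 < ε ≤ 1`**: any proof of the crux must use
`k ≥ 2` for all small `ε` (the relevant regime). -/
theorem not_at_level_one {ε : ℝ} (hε : 0 < ε) (hε1 : ε ≤ 1) (n : ℕ)
    (X Y Z : Finset (Equiv.Perm (Fin n))) : ¬ At ε n 1 X Y Z := by
  rcases Nat.lt_or_ge n 2 with hn | hn
  · exact not_at_of_le_one hε (by omega) 1 X Y Z
  rcases Nat.lt_or_ge n 3 with hn3 | hn3
  · obtain rfl : n = 2 := by omega
    exact not_at_level_one_two hε hε1 X Y Z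
  · exact not_at_level_one_of_three_le hε hn3 X Y Z

end

end Summit.MatrixMultiplication.MatrixMultiplication.Theorems.SnLevelDesigns.Negative
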